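import Summits.ResolutionOfSingularities.ResolutionOfSingularities.Theorems.FrobeniusClosingSteerInsepStepPolyLemma
import Mathlib.RingTheory.Polynomial.Basic
import Mathlib.RingTheory.LocalRing.ResidueField.Basic
import HarnessLib

/-!
# Steer / LEMMA I kernel, file F6a: THE BIVARIATE POLYNOMIAL LEMMA (PL₂) — «two 2-independent inseparable coordinates count double each»

OURS (campaign res-hironaka, rung L ★L-G4, slot W4.1, crux `Steer` stmt-ResolutionOfSingularities-16345; res-L0-w41-plan-1 RULING 155a, kernel of
res-L0-w41-idea-3's LEMMA I `InsepStepNotIsolated`, degree-FOUR near point (res-L0-w41-tri-1 v6.17: the 2-independent `(1 : μ₁ : μ₂)`); res-L0-w41-stub-3 g7,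
blueprint `KERNEL-BLUEPRINT-LemmaI.md` 693d33707585fe97 §2 (PL₂); replaces the role of no printed item; NOT a statement of the manuscript under review
[claim: Hironaka2017, status: under-review]; AI review is weaker than expert review). Theses-free, definition-free, generic commutative algebra.

Setting: `S₀` local (`𝔪₀`), `R` local (the quotient `S₁ ⧸ (X)` of the new member, regular of dimension `2`), `ῑ : S₀ → R` killing `𝔪₀`, elements `v₁, v₂ ∈ R`
(classes of `t = Y/X`, `z' = Z/X`) with `q̄ᵢ := vᵢ² − ῑ ℓᵢ` generating `𝔫 = 𝔪_R`; a further quotient `π : R → R'` onto a local DOMAIN killing `q̄₂` with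
`𝔪_{R'} = (π q̄₁) ≠ 0` and `π⁻¹ 𝔪_{R'} = 𝔫`; cancellation of `q̄₂` one order at a time (`q̄₂ w ∈ 𝔫^{N+1} ⇒ w ∈ 𝔫^N`, order additivity in the regular `R`);
and the 2-INDEPENDENCE clause «`ῑa₀ + ῑa₁v₂ + (ῑb₀ + ῑb₁v₂)v₁ ∈ 𝔫 ⇒ all in 𝔪₀`». Bivariate polynomials are nested, `Ĝ ∈ (S₀[Z'])[T]`, evaluated by
`EV : Z' ↦ v₂, T ↦ v₁`; the «total degree `< 2N`» hypothesis is `deg_{Z'} (coeff_j Ĝ) < 2N − j` for all `j`.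

* `polyLemma_two` — **(PL₂)**: `deg Ĝ < 2N` and `EV Ĝ ∈ 𝔫^N` force every coefficient of `Ĝ` into `𝔪₀`. Proof: (PL₁) `LemmaI.polyLemma_one` in `R'` over the
  coefficient ring `S₀[Z']` with the ideal `J₀ = 𝔪₀[Z'] + (Z'² − ℓ₂)` shows every `T`-coefficient lies in `J₀`; Euclid by `Z'² − ℓ₂` splits
  `Ĝ = (Z'² − ℓ₂)·G' + M` with `M ≡ 0`; cancel `q̄₂` and induct on `N`.
[cite: Matsumura1987, Thm. 17.10] [cite: ZariskiSamuel1960, Ch. VIII §1 Thm. 1] [folklore]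
-/

noncomputable section

-- single-problem summit: the doubled namespace component `ResolutionOfSingularities` is forced
set_option linter.dupNamespace false

namespace Summit.ResolutionOfSingularities.ResolutionOfSingularities.Theorems.SwitchingDichotomy.LemmaI

open IsLocalRing Polynomial

variable {S₀ R R' : Type*} [CommRing S₀] [CommRing R] [CommRing R']

/-! ## §1 Bookkeeping over `S₀[Z']` -/

/-- A polynomial all of whose coefficients lie in an ideal killed by `φ` evaluates to `0`. [folklore] -/
theorem eval₂_eq_zero_of_forall_coeff_mem (φ : S₀ →+* R) {J : Ideal S₀} (hφ : ∀ m ∈ J, φ m = 0) (w : R) {P : S₀[X]}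
    (hP : ∀ k, P.coeff k ∈ J) : P.eval₂ φ w = 0 := by
  rw [eval₂_eq_sum_range]
  exact Finset.sum_eq_zero fun k _ => by rw [hφ _ (hP k), zero_mul]

/-- Nested version: if all coefficients of all coefficients of `Ĝ ∈ (S₀[Z'])[T]` lie in `J`, then `EV Ĝ = 0`. [folklore] -/
theorem evalEval_eq_zero_of_forall_coeff_mem (φ : S₀ →+* R) {J : Ideal S₀} (hφ : ∀ m ∈ J, φ m = 0) (v₁ v₂ : R) {G : S₀[X][X]}
    (hG : ∀ j k, (G.coeff j).coeff k ∈ J) : G.eval₂ (eval₂RingHom φ v₂) v₁ = 0 := by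
  rw [eval₂_eq_sum_range]
  exact Finset.sum_eq_zero fun j _ => by
    rw [coe_eval₂RingHom, eval₂_eq_zero_of_forall_coeff_mem φ hφ v₂ (hG j), zero_mul]

/-- **A polynomial of degree `< 2` in `J₀ = 𝔪₀[Z'] + (Z'² − ℓ₂)` has its two coefficients in `𝔪₀`** (reduce mod `𝔪₀`: a multiple of the monic
quadratic `Z'² − λ₂` over the residue field has degree `≥ 2` or vanishes). [folklore] -/
theorem coeff_mem_of_mem_sup_of_degree_lt_two [IsLocalRing S₀] (ℓ₂ : S₀) {P : S₀[X]}
    (hP : P ∈ (maximalIdeal S₀).map (C : S₀ →+* S₀[X]) ⊔ Ideal.span {X ^ 2 - C ℓ₂}) (hdeg : P.degree < 2) :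
    ∀ k, P.coeff k ∈ maximalIdeal S₀ := by
  obtain ⟨M, hM, W, hW, hMW⟩ := Submodule.mem_sup.mp hP
  obtain ⟨H, rfl⟩ := Ideal.mem_span_singleton'.mp hW
  -- reduce modulo `𝔪₀`
  have hMbar : M.map (residue S₀) = 0 := by
    ext k
    rw [coeff_map, coeff_zero, residue_eq_zero_iff]
    exact (Ideal.mem_map_C_iff.mp hM) k
  have hPbar : P.map (residue S₀) = H.map (residue S₀) * (X ^ 2 - C (residue S₀ ℓ₂)) := by
    rw [← hMW, Polynomial.map_add, hMbar, zero_add, Polynomial.map_mul, Polynomial.map_sub, Polynomial.map_pow, map_X, map_C]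
  have hmonic : (X ^ 2 - C (residue S₀ ℓ₂) : (ResidueField S₀)[X]).Monic := monic_X_pow_sub_C _ two_ne_zero
  have hdeg2 : (X ^ 2 - C (residue S₀ ℓ₂) : (ResidueField S₀)[X]).degree = 2 := by
    rw [degree_X_pow_sub_C (by norm_num)]; rfl
  have hzero : P.map (residue S₀) = 0 := by
    by_contra hne
    have hH : H.map (residue S₀) ≠ 0 := fun h0 => hne (by rw [hPbar, h0, zero_mul])
    have hdegP : (P.map (residue S₀)).degree < 2 := degree_map_le.trans_lt hdeg
    rw [hPbar, degree_mul, hdeg2, degree_eq_natDegree hH] at hdegP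
    have : ((H.map (residue S₀)).natDegree : WithBot ℕ) + 2 < 2 := hdegP
    rw [← Nat.cast_two, ← Nat.cast_add, Nat.cast_lt] at this
    omega
  intro k
  have := congrArg (fun Q => Q.coeff k) hzero
  simp only [coeff_map, coeff_zero, residue_eq_zero_iff] at this
  exact this

/-- Euclid by the monic quadratic `W₂ = Z'² − ℓ₂` inside `J₀ = 𝔪₀[Z'] + (W₂)`: the remainder of a member of `J₀` has coefficients in `𝔪₀`. [folklore] -/
theorem coeff_modByMonic_mem [IsLocalRing S₀] (ℓ₂ : S₀) {A : S₀[X]}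
    (hA : A ∈ (maximalIdeal S₀).map (C : S₀ →+* S₀[X]) ⊔ Ideal.span {X ^ 2 - C ℓ₂}) :
    ∀ k, (A %ₘ (X ^ 2 - C ℓ₂)).coeff k ∈ maximalIdeal S₀ := by
  set W : S₀[X] := X ^ 2 - C ℓ₂ with hW
  have hWm : W.Monic := monic_X_pow_sub_C ℓ₂ two_ne_zero
  have hWdeg : W.degree = 2 := by rw [hW, degree_X_pow_sub_C (by norm_num) ℓ₂]; rfl
  refine coeff_mem_of_mem_sup_of_degree_lt_two ℓ₂ ?_ (by simpa [hWdeg] using degree_modByMonic_lt A hWm)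
  have hdiv : A %ₘ W = A - W * (A /ₘ W) := by rw [eq_sub_iff_add_eq, modByMonic_add_div]
  rw [hdiv]
  exact Ideal.sub_mem _ hA (Ideal.mem_sup_right (Ideal.mul_mem_right _ _ (Ideal.mem_span_singleton_self _)))

/-! ## §2 (PL₂) -/

/-- **(PL₂) — the bivariate polynomial lemma.** See the module docstring for the setting. For every `N` and every `Ĝ ∈ (S₀[Z'])[T]` with
`deg_{Z'} (coeff_j Ĝ) < 2N − j` for all `j` and `EV Ĝ ∈ 𝔫^N` (`EV : Z' ↦ v₂, T ↦ v₁` through `ῑ`), every coefficient of every coefficient of `Ĝ` lies in `𝔪₀`.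
[cite: Matsumura1987, Thm. 17.10] [cite: ZariskiSamuel1960, Ch. VIII §1 Thm. 1] [folklore] -/
theorem polyLemma_two [IsLocalRing S₀] [IsLocalRing R] [IsLocalRing R'] [IsDomain R']
    (ῑ : S₀ →+* R) (hῑ : ∀ m ∈ maximalIdeal S₀, ῑ m = 0) (v₁ v₂ : R) (ℓ₁ ℓ₂ : S₀)
    (hn : Ideal.span {v₁ ^ 2 - ῑ ℓ₁, v₂ ^ 2 - ῑ ℓ₂} = maximalIdeal R)
    (π : R →+* R') (hπ₂ : π (v₂ ^ 2 - ῑ ℓ₂) = 0) (hπm : Ideal.span {π (v₁ ^ 2 - ῑ ℓ₁)} = maximalIdeal R')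
    (hπ0 : π (v₁ ^ 2 - ῑ ℓ₁) ≠ 0) (hπloc : ∀ w, π w ∈ maximalIdeal R' → w ∈ maximalIdeal R)
    (hcancel : ∀ (N : ℕ) (w : R), (v₂ ^ 2 - ῑ ℓ₂) * w ∈ maximalIdeal R ^ (N + 1) → w ∈ maximalIdeal R ^ N)
    (hLI : ∀ a₀ a₁ b₀ b₁ : S₀, ῑ a₀ + ῑ a₁ * v₂ + (ῑ b₀ + ῑ b₁ * v₂) * v₁ ∈ maximalIdeal R →
      a₀ ∈ maximalIdeal S₀ ∧ a₁ ∈ maximalIdeal S₀ ∧ b₀ ∈ maximalIdeal S₀ ∧ b₁ ∈ maximalIdeal S₀) :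
    ∀ (N : ℕ) (G : S₀[X][X]), (∀ j, (G.coeff j).degree < ((2 * N - j : ℕ) : WithBot ℕ)) →
      G.eval₂ (eval₂RingHom ῑ v₂) v₁ ∈ maximalIdeal R ^ N → ∀ j k, (G.coeff j).coeff k ∈ maximalIdeal S₀ := by
  classical
  -- ### the data of (PL₁) in `R'` over `S₀[Z']`
  set W : S₀[X] := X ^ 2 - C ℓ₂ with hW
  have hWm : W.Monic := monic_X_pow_sub_C ℓ₂ two_ne_zero
  have hWdeg : W.degree = 2 := by rw [hW, degree_X_pow_sub_C (by norm_num) ℓ₂]; rfl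
  have hWnat : W.natDegree = 2 := natDegree_eq_of_degree_eq_some hWdeg
  set J₀ : Ideal S₀[X] := (maximalIdeal S₀).map (C : S₀ →+* S₀[X]) ⊔ Ideal.span {W} with hJ₀
  set ι' : S₀[X] →+* R' := π.comp (eval₂RingHom ῑ v₂) with hι'
  have hWev : eval₂ ῑ v₂ W = v₂ ^ 2 - ῑ ℓ₂ := by simp [hW]
  have hmapC : ∀ M ∈ (maximalIdeal S₀).map (C : S₀ →+* S₀[X]), eval₂ ῑ v₂ M = 0 := fun M hM =>
    eval₂_eq_zero_of_forall_coeff_mem ῑ hῑ v₂ (Ideal.mem_map_C_iff.mp hM)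
  have hι'J : ∀ m ∈ J₀, ι' m = 0 := by
    intro m hm
    obtain ⟨M, hM, W', hW', rfl⟩ := Submodule.mem_sup.mp hm
    obtain ⟨H, rfl⟩ := Ideal.mem_span_singleton'.mp hW'
    rw [hι', RingHom.comp_apply, map_add, coe_eval₂RingHom, hmapC M hM, zero_add, eval₂_mul, hWev, map_mul, hπ₂, mul_zero]
  have hq' : Ideal.span {π v₁ ^ 2 - ι' (C ℓ₁)} = maximalIdeal R' := by
    rw [← hπm, hι', RingHom.comp_apply, coe_eval₂RingHom, eval₂_C, ← map_pow, ← map_sub]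
  have hq'0 : π v₁ ^ 2 - ι' (C ℓ₁) ≠ 0 := by
    rwa [hι', RingHom.comp_apply, coe_eval₂RingHom, eval₂_C, ← map_pow, ← map_sub]
  have hLI' : ∀ A B : S₀[X], ι' A + ι' B * π v₁ ∈ maximalIdeal R' → A ∈ J₀ ∧ B ∈ J₀ := by
    intro A B hAB
    -- Euclid by `W`
    have hdA := modByMonic_add_div A W
    have hdB := modByMonic_add_div B W
    have hrA := eq_C_add_C_mul_X_of_degree_lt_two (by simpa [hWdeg] using degree_modByMonic_lt A hWm)
    have hrB := eq_C_add_C_mul_X_of_degree_lt_two (by simpa [hWdeg] using degree_modByMonic_lt B hWm)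
    set a₀ := (A %ₘ W).coeff 0; set a₁ := (A %ₘ W).coeff 1; set b₀ := (B %ₘ W).coeff 0; set b₁ := (B %ₘ W).coeff 1
    have hWJ : ∀ Q, W * Q ∈ J₀ := fun Q => Ideal.mem_sup_right (Ideal.mul_mem_right _ _ (Ideal.mem_span_singleton_self _))
    have hι'W : ι' W = 0 := hι'J W (Ideal.mem_sup_right (Ideal.mem_span_singleton_self _))
    have hι'A : ι' A = π (ῑ a₀ + ῑ a₁ * v₂) := by
      conv_lhs => rw [← hdA, hrA]
      rw [map_add, map_mul, hι'W, zero_mul, add_zero]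
      simp [hι']
    have hι'B : ι' B = π (ῑ b₀ + ῑ b₁ * v₂) := by
      conv_lhs => rw [← hdB, hrB]
      rw [map_add, map_mul, hι'W, zero_mul, add_zero]
      simp [hι']
    have hmem : ῑ a₀ + ῑ a₁ * v₂ + (ῑ b₀ + ῑ b₁ * v₂) * v₁ ∈ maximalIdeal R := by
      refine hπloc _ ?_
      rw [map_add, map_mul, ← hι'A, ← hι'B]
      exact hAB
    obtain ⟨ha₀, ha₁, hb₀, hb₁⟩ := hLI a₀ a₁ b₀ b₁ hmem
    have hCmem : ∀ {c : S₀}, c ∈ maximalIdeal S₀ → (C c : S₀[X]) ∈ J₀ := fun hc =>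
      Ideal.mem_sup_left (Ideal.mem_map_of_mem _ hc)
    constructor
    · rw [← hdA, hrA]
      exact Ideal.add_mem _ (Ideal.add_mem _ (hCmem ha₀) (Ideal.mul_mem_right _ _ (hCmem ha₁))) (hWJ _)
    · rw [← hdB, hrB]
      exact Ideal.add_mem _ (Ideal.add_mem _ (hCmem hb₀) (Ideal.mul_mem_right _ _ (hCmem hb₁))) (hWJ _)
  have PL1 := polyLemma_one ι' J₀ hι'J (π v₁) (C ℓ₁) hq' hq'0 hLI'
  have hnmap : (maximalIdeal R).map π ≤ maximalIdeal R' := by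
    rw [← hn, Ideal.map_span, Set.image_insert_eq, Set.image_singleton, hπ₂, Ideal.span_le]
    rintro w hw
    simp only [Set.mem_insert_iff, Set.mem_singleton_iff] at hw
    rcases hw with rfl | rfl
    · rw [← hπm]; exact Ideal.mem_span_singleton_self _
    · exact zero_mem _
  -- ### induction on `N`
  intro N
  induction N with
  | zero =>
    intro G hdeg _ j k
    have : G.coeff j = 0 := degree_eq_bot.mp (Nat.WithBot.lt_zero_iff.mp (by simpa using hdeg j))
    rw [this, coeff_zero]; exact zero_mem _
  | succ N ih =>
    intro G hdeg hev j k
    -- (1) every `T`-coefficient lies in `J₀`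
    have hGdeg : G.degree < (2 * (N + 1) : ℕ) := by
      rw [degree_lt_iff_coeff_zero]
      intro m hm
      have := hdeg m
      rw [show 2 * (N + 1) - m = 0 by omega] at this
      exact degree_eq_bot.mp (Nat.WithBot.lt_zero_iff.mp (by simpa using this))
    have hGev' : G.eval₂ ι' (π v₁) ∈ maximalIdeal R' ^ (N + 1) := by
      have h1 : G.eval₂ ι' (π v₁) = π (G.eval₂ (eval₂RingHom ῑ v₂) v₁) := by rw [hι', Polynomial.hom_eval₂]
      rw [h1]
      exact Ideal.pow_right_mono hnmap (N + 1) (by rw [← Ideal.map_pow]; exact Ideal.mem_map_of_mem π hev)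
    have hcoeffJ : ∀ j, G.coeff j ∈ J₀ := PL1 (N + 1) G hGdeg hGev'
    -- (2) Euclid by `W` coefficientwise: `G = C W · G' + M`, `M ≡ 0`
    have hRm0 : ∀ j k, (G.coeff j %ₘ W).coeff k ∈ maximalIdeal S₀ := fun j => coeff_modByMonic_mem ℓ₂ (hcoeffJ j)
    have hsplitj : ∀ j, G.coeff j = W * (G.coeff j /ₘ W) + G.coeff j %ₘ W := fun j => by
      rw [add_comm, modByMonic_add_div]
    set G' : S₀[X][X] := ∑ j ∈ Finset.range (2 * (N + 1)), monomial j (G.coeff j /ₘ W) with hG'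
    set M : S₀[X][X] := ∑ j ∈ Finset.range (2 * (N + 1)), monomial j (G.coeff j %ₘ W) with hM
    have hGnat : G.natDegree < 2 * (N + 1) := by
      by_cases hG0 : G = 0
      · rw [hG0, natDegree_zero]; omega
      · have := hGdeg; rw [degree_eq_natDegree hG0] at this; exact_mod_cast this
    have hGsplit : G = C W * G' + M := by
      conv_lhs => rw [as_sum_range' G (2 * (N + 1)) hGnat]
      rw [hG', hM, Finset.mul_sum, ← Finset.sum_add_distrib]
      refine Finset.sum_congr rfl fun j _ => ?_
      rw [hsplitj j, map_add, ← C_mul_monomial, ← hsplitj j]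
    have hcoeffG' : ∀ j, G'.coeff j = if j < 2 * (N + 1) then G.coeff j /ₘ W else 0 := fun j => by
      simp only [hG', finsetSum_coeff, coeff_monomial, Finset.sum_ite_eq', Finset.mem_range]
    have hcoeffM : ∀ j, M.coeff j = if j < 2 * (N + 1) then G.coeff j %ₘ W else 0 := fun j => by
      simp only [hM, finsetSum_coeff, coeff_monomial, Finset.sum_ite_eq', Finset.mem_range]
    have hM0 : M.eval₂ (eval₂RingHom ῑ v₂) v₁ = 0 := by
      refine evalEval_eq_zero_of_forall_coeff_mem ῑ hῑ v₁ v₂ fun j k => ?_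
      rw [hcoeffM]
      split_ifs
      · exact hRm0 j k
      · rw [coeff_zero]; exact zero_mem _
    -- (3) cancel `q̄₂` and induct
    have hev' : G'.eval₂ (eval₂RingHom ῑ v₂) v₁ ∈ maximalIdeal R ^ N := by
      refine hcancel N _ ?_
      have : (v₂ ^ 2 - ῑ ℓ₂) * G'.eval₂ (eval₂RingHom ῑ v₂) v₁ = G.eval₂ (eval₂RingHom ῑ v₂) v₁ := by
        conv_rhs => rw [hGsplit]
        rw [eval₂_add, eval₂_mul, eval₂_C, coe_eval₂RingHom, hWev, hM0, add_zero]
      rw [this]; exact hev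
    have hdeg' : ∀ j, (G'.coeff j).degree < ((2 * N - j : ℕ) : WithBot ℕ) := by
      intro j
      rw [hcoeffG']
      split_ifs with hj
      · by_cases hQ0 : G.coeff j /ₘ W = 0
        · rw [hQ0, degree_zero]; exact WithBot.bot_lt_coe _
        · have hA0 : G.coeff j ≠ 0 := by
            intro h0; apply hQ0; rw [h0, zero_divByMonic]
          have hAge : ¬ (G.coeff j).degree < W.degree := fun hlt => hQ0 ((divByMonic_eq_zero_iff hWm).mpr hlt)
          have hAnat2 : 2 ≤ (G.coeff j).natDegree := by
            rw [not_lt, hWdeg, degree_eq_natDegree hA0] at hAge; exact_mod_cast hAge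
          have hAlt : (G.coeff j).natDegree < 2 * (N + 1) - j := by
            have := hdeg j; rw [degree_eq_natDegree hA0] at this; exact_mod_cast this
          have hQnat : (G.coeff j /ₘ W).natDegree = (G.coeff j).natDegree - 2 := by
            rw [natDegree_divByMonic _ hWm, hWnat]
          rw [degree_eq_natDegree hQ0, hQnat]
          exact_mod_cast (show (G.coeff j).natDegree - 2 < 2 * N - j by omega)
      · rw [degree_zero]; exact WithBot.bot_lt_coe _
    have hIH := ih G' hdeg' hev'
    -- (4) conclude
    by_cases hj : j < 2 * (N + 1)
    · have hQmem : ∀ k', (G.coeff j /ₘ W).coeff k' ∈ maximalIdeal S₀ := fun k' => by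
        have := hIH j k'; rwa [hcoeffG', if_pos hj] at this
      have hWQ : ∀ k', (W * (G.coeff j /ₘ W)).coeff k' ∈ maximalIdeal S₀ := by
        rw [← Ideal.mem_map_C_iff]
        exact Ideal.mul_mem_left _ _ (Ideal.mem_map_C_iff.mpr hQmem)
      rw [hsplitj j, coeff_add]
      exact Ideal.add_mem _ (hWQ k) (hRm0 j k)
    · have : G.coeff j = 0 := by
        have := hdeg j
        rw [show 2 * (N + 1) - j = 0 by omega] at this
        exact degree_eq_bot.mp (Nat.WithBot.lt_zero_iff.mp (by simpa using this))
      rw [this, coeff_zero]; exact zero_mem _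

end Summit.ResolutionOfSingularities.ResolutionOfSingularities.Theorems.SwitchingDichotomy.LemmaI

end
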